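import Summits.NavierStokesRegularity.NavierStokesRegularity.Theorems.ExtremiserTransiencePinnedDepletionDefs
import Summits.NavierStokesRegularity.NavierStokesRegularity.Theorems.ExtremiserTransiencePerFlowEfficientTimesLogDensity
import HarnessLib

/-!
# Crux `NearExtremalTransiencePerFlow` (stmt-NavierStokesRegularity-26567), LINE g13-β `relay` (ns-idea-5 g13):
# THE ONE-CELL SANDWICH in the kernel — strong pinned depletion ⇒ D♭ `CellRelayDecomposition`

Theorems file (`--supports stmt-NavierStokesRegularity-26567`, helper; prover seat ns-net-p1 g17).  Critic idea-crit-4 g10's price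
P1 on LINE g13-β `relay` (verdict 15:23:42Z, paid in the D♭ docstring of `Lines/relay.lean` REV 2 09c2e443f072 as a LABEL) asked that
the heart D♭ `CellRelayDecomposition` (texts of record `…Theorems.ExtremiserTransiencePinnedDepletionDefs`) be recorded as «STRONG PINNED
DEPLETION, CELL-LICENSED»: the weight/quotient families of D♭ are an existential licence, and the ONE-CELL instance `w₀ ≡ 1`,
`q₀ =` the flow's own depletion quotient shows

  `StrongPinnedDepletion ⇒ D♭ ⇒ (R♭) PinnedDepletedFraction`.

This file proves the FIRST implication in the kernel (the second is `PinnedDepletion.pinnedDepletedFraction_of_cellRelayDecomposition`):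

* `CellRelayDecomposition.of_strongPinnedDepletion` — if every violator has, for every window package `(Θ, G, H, τ₁)`, a FIXED margin
  `δ₀ ∈ (0, κ⋆]` and a fraction `η ≥ 0` with `2η < 1` such that on every PINNED admissible window `I` the `(κ⋆ − δ₀)`-EFFICIENT times
  (`∃ M', ‖u(t')‖ ≤ M' ∧ (κ⋆ − δ₀)·M'·√Z·√P < |J(t')|`, the complement of the `δ₀`-depleted times) have measure `≤ η|I|`, then
  `CellRelayDecomposition` holds — with `Λ = 1`, `w₀ ≡ 1`, `wᵢ ≡ 0 (i ≥ 1)`, `q₀ = k` the CANONICAL minimal flow-wise coefficient of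
  `DepletionLadder.PerFlow.efficientTimes_logDensity_of_not_perFlow` (measurable, `k ≤ κ⋆` on `[0,T)`, flow-wise clause
  `|J(t)| ≤ k(t)·M'·√Z·√P` = DOMINATION, read-back `m < k(t) ⇒ t is strictly m-efficient` = TRANSIENCE transfer), `qᵢ ≡ 0 (i ≥ 1)`.

So D♭ as typed sits between strong (fixed `δ₀`, efficient fraction `< 1/2`) and weak (`∃ ε`, depleted fraction `≥ ε`) pinned
depletion, exactly as the card says; the crowd content of the relay line lives in R♭ and in the sub-convexity lemma
(`…PinnedDepletionDisjointCells.relay_domination`).  HONEST FRAMING: a statement about hypothetical Type-I singular flows violating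
the crux; strong pinned depletion, D♭, the junction, ⟨26567⟩ and NS regularity are OPEN; nothing about Navier–Stokes regularity or
blow-up is proved; no summit is proved by a line. [folklore]
-/

noncomputable section

open scoped Topology InnerProductSpace RealInnerProductSpace ENNReal ContDiff
open MeasureTheory Filter Set Metric
open Literature.Analysis.FluidPDE
open Summit.NavierStokesRegularity.NavierStokesRegularity.Theorems
open Summit.NavierStokesRegularity.NavierStokesRegularity.Theorems.DepletionLadder.KStar.HalfSpace
open Summit.NavierStokesRegularity.NavierStokesRegularity.Theorems.NearExtremalTransiencePerFlow.ZoneTransversality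

namespace Summit.NavierStokesRegularity.NavierStokesRegularity.Theorems.NearExtremalTransiencePerFlow.PinnedDepletion

-- the summit's namespace repeats the problem name by convention (D-0017)
set_option linter.dupNamespace false

/-- **The one-cell sandwich: STRONG PINNED DEPLETION ⇒ D♭ `CellRelayDecomposition`** (critic idea-crit-4 g10 P1 on LINE g13-β `relay`,
crux stmt-NavierStokesRegularity-26567).  Hypothesis (strong pinned depletion, per violator): for every window package there are a fixed
margin `0 < δ₀ ≤ κ⋆` and `η ≥ 0` with `2η < 1` such that on every PINNED admissible window (`M = C√ν/√(T−t)`, Taylor lock, gradient,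
heights) the `(κ⋆ − δ₀)`-efficient times have measure `≤ η·|I|`.  Conclusion: D♭, witnessed by ONE cell — `Λ = 1`, `w₀ ≡ 1`, `q₀ =` the
canonical flow-wise coefficient `k` (`efficientTimes_logDensity_of_not_perFlow`: domination is its flow-wise clause, `q₀ ≤ κ⋆` its
minimality against the universal constant, transience its read-back), all other cells `wᵢ = qᵢ ≡ 0`. [folklore] -/
theorem CellRelayDecomposition.of_strongPinnedDepletion
    (h : ∀ (C ν T : ℝ) (u : ℝ → EuclideanSpace ℝ (Fin 3) → EuclideanSpace ℝ (Fin 3)) (p : ℝ → EuclideanSpace ℝ (Fin 3) → ℝ),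
      IsViolator C ν T u p →
      ∀ (Θ G H τ₁ : ℝ), 0 < Θ → 0 < G → 0 < H → 0 < τ₁ →
      ∃ δ₀ η : ℝ, 0 < δ₀ ∧ δ₀ ≤ kStar ∧ 0 ≤ η ∧ 2 * η < 1 ∧
      ∀ (t M : ℝ), 0 ≤ t → 0 < M → t + τ₁ * ν / M ^ 2 < T → M = C * Real.sqrt ν / Real.sqrt (T - t) →
        (∀ x, ‖u t x‖ ≤ M) →
        (∫ x, ‖curl (u t) x‖ ^ 2) ≤ Θ * (ν / M) ^ 2 * (∫ x, frobeniusNormSq (fderiv ℝ (curl (u t)) x)) →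
        (∀ x, ‖fderiv ℝ (u t) x‖ ≤ G * M ^ 2 / ν) →
        (∀ t' ∈ Set.Icc t (t + τ₁ * ν / M ^ 2), ∀ x, ‖u t' x‖ ≤ H * M) →
        volume ({t' : ℝ | ∃ M' : ℝ, (∀ x, ‖u t' x‖ ≤ M') ∧
            (kStar - δ₀) * M' * Real.sqrt (∫ x, ‖curl (u t') x‖ ^ 2) *
              Real.sqrt (∫ x, frobeniusNormSq (fderiv ℝ (curl (u t')) x)) <
            |∫ x, ⟪curl (u t') x, fderiv ℝ (u t') x (curl (u t') x)⟫_ℝ|} ∩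
          Set.Icc t (t + τ₁ * ν / M ^ 2)) ≤ ENNReal.ofReal (η * (τ₁ * ν / M ^ 2))) :
    CellRelayDecomposition := by
  intro C ν T u p hV Θ G H τ₁ hΘ hG hH hτ₁
  obtain ⟨hC, hν, hT, hsol, hLH, hdec, hrate, hsing, hno⟩ := hV
  -- the canonical coefficient of THIS flow: measurable, flow-wise clause (domination), `k ≤ κ⋆`, read-back
  obtain ⟨k, hkm, hk01, hcl, hkle, hread, -⟩ :=
    DepletionLadder.PerFlow.efficientTimes_logDensity_of_not_perFlow hν hT hsol hLH hdec hno
  have hkle' : ∀ t' ∈ Set.Ico 0 T, k t' ≤ kStar := by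
    intro t' ht'
    unfold kStar udcSet
    exact hkle t' ht'
  obtain ⟨δ₀, η, hδ₀, hδ₀κ, hη, h2η, hwin⟩ :=
    h C ν T u p ⟨hC, hν, hT, hsol, hLH, hdec, hrate, hsing, hno⟩ Θ G H τ₁ hΘ hG hH hτ₁
  refine ⟨δ₀, η, 1, hδ₀, hδ₀κ, hη, le_rfl, by linarith, ?_⟩
  intro t M ht hM htT hpin hMb hlock hgrad hheights
  have hstrong := hwin t M ht hM htT hpin hMb hlock hgrad hheights
  -- the window lies inside `[0, T)`
  have hIT : ∀ t' ∈ Set.Icc t (t + τ₁ * ν / M ^ 2), t' ∈ Set.Ico 0 T :=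
    fun t' ht' => ⟨ht.trans ht'.1, lt_of_le_of_lt ht'.2 htT⟩
  -- ONE cell: `w₀ ≡ 1`, `q₀ = k`; all other cells carry no weight
  refine ⟨fun i _ => if i = 0 then (1 : ℝ) else 0, fun i t' => if i = 0 then k t' else 0,
    fun i => measurable_const, fun i => ?_, fun i t' => ?_, fun t' _ => ?_, fun i t' ht' => ?_, fun i t' _ => ?_,
    fun i => ?_, fun t' ht' M' hM' => ?_⟩
  · -- measurability of the quotients
    by_cases hi : i = 0
    · simp only [hi, if_true]; exact hkm
    · simp only [hi, if_false]; exact measurable_const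
  · -- weights are non-negative
    by_cases hi : i = 0
    · simp only [hi, if_true]; exact zero_le_one
    · simp only [hi, if_false]; exact le_rfl
  · -- total weight `= 1 ≤ 1`
    refine ⟨(hasSum_ite_eq 0 (1 : ℝ)).summable, ?_⟩
    rw [tsum_ite_eq]
  · -- quotients `≤ κ⋆`
    by_cases hi : i = 0
    · simp only [hi, if_true]; exact hkle' t' (hIT t' ht')
    · simp only [hi, if_false]; exact kStar_pos.le
  · -- persistence with `Λ = 1` (constant weights)
    rw [one_mul]
  · -- individual transience: cell `0` by read-back + strong depletion; the other cells are never efficient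
    by_cases hi : i = 0
    · simp only [hi, if_true]
      refine le_trans (measure_mono ?_) hstrong
      rintro t' ⟨hkt', ht'I⟩
      refine ⟨?_, ht'I⟩
      have hm0 : 0 ≤ kStar - δ₀ := by linarith
      exact hread t' (hIT t' ht'I) (kStar - δ₀) hm0 hkt'
    · simp only [hi, if_false]
      have hempty : ({t' : ℝ | kStar - δ₀ < 0} ∩ Set.Icc t (t + τ₁ * ν / M ^ 2)) = ∅ := by
        ext t'
        simp only [Set.mem_inter_iff, Set.mem_setOf_eq, Set.mem_empty_iff_false, iff_false, not_and]
        intro hlt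
        exact absurd hlt (by linarith)
      rw [hempty, measure_empty]
      exact bot_le
  · -- domination: `Σ' wᵢqᵢ = k(t')` and the flow-wise clause of the canonical coefficient
    have hsum : ∑' i : ℕ, (if i = 0 then (1 : ℝ) else 0) * (if i = 0 then k t' else 0) = k t' := by
      have hterm : ∀ i : ℕ, (if i = 0 then (1 : ℝ) else 0) * (if i = 0 then k t' else 0) = if i = 0 then k t' else 0 := by
        intro i
        by_cases hi : i = 0
        · simp only [hi, if_true, one_mul]
        · simp only [hi, if_false, zero_mul]
      rw [tsum_congr hterm, tsum_ite_eq]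
    rw [hsum]
    exact hcl t' (hIT t' ht') M' hM'

end Summit.NavierStokesRegularity.NavierStokesRegularity.Theorems.NearExtremalTransiencePerFlow.PinnedDepletion

end
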